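import Literature.Probability.RandomPlanarGeometry.SLEKappaRhoRegular
import Literature.Probability.RandomPlanarGeometry.SLEKappaRhoLogCut
import HarnessLib

/-!
# The real flows of SLE(κ, ρ) as Itô processes, and the martingales `logCut δ (X_t) - ∫₀ᵗ (L logCut δ)(X_s, J_s) ds`

Stochastic-calculus step of the Koebe/log-derivative route to the named fact
`Literature.Probability.RandomPlanarGeometry.SLEKappaRho.ae_forall_ofReal_notMem_closure_hullUnion`
(`SLEKappaRhoFillVersion`), after

* S. Rohde, O. Schramm, *Basic properties of SLE*, Ann. of Math. **161** (2005), proof of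
  Lemma 7.2 (p. 909) ("a straightforward application of Itô's formula");
* G. F. Lawler, O. Schramm, W. Werner, *Conformal restriction: the chordal case*, J. Amer. Math.
  Soc. **16** (2003), §8.3–8.4 (the SLE(κ, ρ) flow `dX = (2/X) dt - dW`, `dW = ρ dt/Z + √κ dB`).

For a regular version `(W', J)` of an SLE(κ, ρ) driving process `W`
(`SLEKappaRho.RegularPair`, `SLEKappaRhoRegular`) and a point `x > 0` that is a.s. never swallowed:

* `SLEKappaRho.flowReg W' x = max 0 (dyadicReg (flowProc W' x))` — the clamped progressive
  version of the real flow from `x`: progressively measurable, `≥ 0`, equal to `x` at time `0`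
  for every sample, and a.s. equal at all times to the frozen real flow `realFlowStop (W · ω) x`;
* `RegularPair.isItoProcess_flowReg` — it is an **Itô process**
  `X_t = x + ∫₀ᵗ (2/X_s - ρ J_s) ds + ∫₀ᵗ (-√κ) dB_s` (the integrated Loewner equation
  `RegularPair.ae_flowProc_eq_integral` and `isItoIntegral_const_brownian`);
* `RegularPair.martingale_logCut_flowReg` — for every level `δ > 0`,
  **`logCut δ (X_t) - ∫₀ᵗ logCutDrift κ ρ δ (X_s) (J_s) ds` is a martingale**, where
  `logCutDrift κ ρ δ v j = logCutGen κ δ v - ρ j logCutD δ v` is the Itô drift of the `C²` cut-off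
  logarithm along the flow (`martingale_apply_sub_timeIntegral_of_deriv_bounded`, `SLEKappaRhoLogCut`).

No named fact is introduced.
-/

noncomputable section

open Set Filter Topology MeasureTheory
open scoped NNReal
open Literature.Analysis.FunctionSpaces Literature.Probability.Process

namespace Literature.Probability.RandomPlanarGeometry

namespace SLEKappaRho

/-! ### The clamped progressive version of a real flow -/

/-- **The clamped progressive real flow** of the driving process `W'` from `x`:
`max 0 (dyadicReg (flowProc W' x))`. [folklore] -/
def flowReg (W' : ℝ≥0 → (ℝ≥0 → ℝ) → ℝ) (x : ℝ) : ℝ≥0 → (ℝ≥0 → ℝ) → ℝ :=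
  fun t ω ↦ max 0 (dyadicReg (Loewner.flowProc W' x) t ω)

/-- The **Itô drift of `logCut δ` along the SLE(κ, ρ) flow**:
`logCutDrift κ ρ δ v j = logCutGen κ δ v - ρ j logCutD δ v` (`= (2/v - ρ j) f'(v) + (κ/2) f''(v)` for
`f = logCut δ`). [cite: RohdeSchramm2005, proof of Lemma 7.2 (p. 909)] -/
def logCutDrift (κ ρ δ v j : ℝ) : ℝ := logCutGen κ δ v - ρ * j * logCutD δ v

/-- The Itô drift `(2/v - ρ j) f' + ½ (-√κ)² f''` of `f = logCut δ` is `logCutDrift κ ρ δ v j`.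
[folklore] -/
theorem itoDrift_logCut_eq (κ : ℝ≥0) (ρ : ℝ) {δ : ℝ} (hδ : 0 < δ) (v j : ℝ) :
    (2 / v - ρ * j) * deriv (logCut δ) v + 2⁻¹ * (-Real.sqrt κ) ^ 2 * iteratedDeriv 2 (logCut δ) v =
      logCutDrift κ ρ δ v j := by
  rw [deriv_logCut hδ, iteratedDeriv_two_logCut hδ, neg_sq, Real.sq_sqrt κ.coe_nonneg, logCutDrift,
    logCutGen]
  ring

variable {W' : ℝ≥0 → (ℝ≥0 → ℝ) → ℝ} {x : ℝ}

/-- `flowReg ≥ 0`. [folklore] -/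
theorem flowReg_nonneg (W' : ℝ≥0 → (ℝ≥0 → ℝ) → ℝ) (x : ℝ) (t : ℝ≥0) (ω : ℝ≥0 → ℝ) :
    0 ≤ flowReg W' x t ω :=
  le_max_left _ _

/-- On a continuous driving path starting below `x`, the clamped progressive flow is the flow
process. [folklore] -/
theorem flowReg_eq_of_continuous {ω : ℝ≥0 → ℝ} (hc : Continuous fun s ↦ W' s ω) (hx : W' 0 ω < x)
    (t : ℝ≥0) : flowReg W' x t ω = Loewner.flowProc W' x t ω := by
  rw [flowReg, dyadicReg_apply_of_continuous (Loewner.continuous_flowProc hc hx) t,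
    max_eq_right (Loewner.flowProc_nonneg hc hx t)]

namespace RegularPair

variable {κ : ℝ≥0} {ρ : ℝ} {W J : ℝ≥0 → (ℝ≥0 → ℝ) → ℝ}

/-- The clamped progressive flow of a regular version is progressively measurable (`x > 0`).
[folklore] -/
theorem isStronglyProgressive_flowReg (h : RegularPair κ ρ W W' J) (hx : 0 < x) :
    IsStronglyProgressive brownianFiltration (flowReg W' x) :=
  IsStronglyProgressive.continuous_comp (isStronglyProgressive_dyadicReg (h.adapted_flowProc hx))
    (continuous_const.max continuous_id)

/-- The clamped progressive flow is strongly adapted. [folklore] -/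
theorem stronglyAdapted_flowReg (h : RegularPair κ ρ W W' J) (hx : 0 < x) :
    StronglyAdapted brownianFiltration (flowReg W' x) :=
  (h.isStronglyProgressive_flowReg hx).stronglyAdapted

/-- The clamped progressive flow starts at `x`, for every sample (`x > 0 = W'_0`). [folklore] -/
theorem flowReg_zero (h : RegularPair κ ρ W W' J) (hx : 0 < x) (ω : ℝ≥0 → ℝ) :
    flowReg W' x 0 ω = x := by
  have hcont := Loewner.continuous_drivingUpTo W' 0 ω
  have h0 : Loewner.drivingUpTo W' 0 ω 0 = 0 := by rw [Loewner.drivingUpTo_apply_zero, h.apply_zero]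
  have hx' : x ≠ Loewner.drivingUpTo W' 0 ω 0 := by rw [h0]; exact hx.ne'
  rw [flowReg, dyadicReg_apply_zero]
  show max 0 (Loewner.realFlowStop (Loewner.drivingUpTo W' 0 ω) x 0) = x
  rw [Loewner.realFlowStop_zero_of_ne hcont hx', h0, sub_zero, max_eq_right hx.le]

/-- **A.s. the clamped progressive flow is the frozen real flow of `W`** at all times.
[cite: Lawler2005ConformallyInvariant, Ch. 4 §4.1] -/
theorem ae_flowReg_eq (h : RegularPair κ ρ W W' J) (hx : 0 < x) :
    ∀ᵐ ω ∂preWienerMeasure, ∀ t,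
      flowReg W' x t ω = Loewner.realFlowStop (fun s ↦ W s ω) x t := by
  filter_upwards [h.ae_continuous, h.ae_flowProc_eq] with ω hc hflow t
  have hx0 : W' 0 ω < x := by rw [h.apply_zero]; exact hx
  rw [flowReg_eq_of_continuous hc hx0, hflow]

/-- The drift `2/X - ρ J` of the clamped progressive flow is progressively measurable.
[folklore] -/
theorem isStronglyProgressive_drift (h : RegularPair κ ρ W W' J) (hx : 0 < x) :
    IsStronglyProgressive brownianFiltration fun s ω ↦ 2 / flowReg W' x s ω - ρ * J s ω := by
  have h1 : IsStronglyProgressive brownianFiltration (along (fun (_ : ℝ) (v : ℝ) ↦ 2 / v) (flowReg W' x)) :=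
    IsStronglyProgressive.comp_measurable₂ (h.isStronglyProgressive_flowReg hx)
      (measurable_const.div measurable_snd)
  exact h1.sub ((isStronglyProgressive_const _ ρ).mul h.progressive)

/-- **The clamped progressive flow from a never-swallowed point is an Itô process**:
`X_t = x + ∫₀ᵗ (2/X_s - ρ J_s) ds + ∫₀ᵗ (-√κ) dB_s` (a.s. for all `t`), with drift locally
integrable a.s. — the integrated Loewner equation of the regular version
(`RegularPair.ae_flowProc_eq_integral`) read along the clamped progressive flow, which a.s.
agrees with the flow process at all times; the stochastic term is `-√κ B`
(`isItoIntegral_const_brownian`). [cite: LawlerSchrammWerner2003Restriction, §8.3–8.4 (pp. 36–38)] -/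
theorem isItoProcess_flowReg (h : RegularPair κ ρ W W' J) (hx : 0 < x)
    (hT : ∀ᵐ ω ∂preWienerMeasure, Loewner.swallowingTime (fun s ↦ W s ω) x = ⊤) :
    IsItoProcess (flowReg W' x) (fun s ω ↦ 2 / flowReg W' x s ω - ρ * J s ω)
      (fun _ _ ↦ -Real.sqrt κ) brownian brownianFiltration preWienerMeasure := by
  -- the good samples
  have hgood : ∀ᵐ ω ∂preWienerMeasure, (∀ t, flowReg W' x t ω = Loewner.flowProc W' x t ω) ∧
      (∀ t : ℝ≥0, IntervalIntegrable (fun s : ℝ ↦ 2 / Loewner.flowProc W' x s.toNNReal ω) volume 0 t) ∧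
      (∀ t : ℝ≥0, IntervalIntegrable (fun s : ℝ ↦ J s.toNNReal ω) volume 0 t) ∧
      ∀ t : ℝ≥0, Loewner.flowProc W' x t ω =
        x + (∫ s in (0 : ℝ)..t, (2 / Loewner.flowProc W' x s.toNNReal ω - ρ * J s.toNNReal ω)) -
          Real.sqrt κ * brownian t ω := by
    filter_upwards [h.ae_continuous, h.ae_flowProc_eq_integral, hT] with ω hc hint hTω
    have hx0 : W' 0 ω < x := by rw [h.apply_zero]; exact hx
    obtain ⟨-, -, h2, hJ, heq⟩ := hint x hx hTω
    exact ⟨fun t ↦ flowReg_eq_of_continuous hc hx0 t, h2, hJ, heq⟩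
  refine ⟨?_, fun t ω ↦ -Real.sqrt κ * brownian t ω, isItoIntegral_const_brownian _, ?_⟩
  · filter_upwards [hgood] with ω ⟨hreg, h2, hJ, _⟩ t
    have hfun : (fun s : ℝ ↦ 2 / flowReg W' x s.toNNReal ω - ρ * J s.toNNReal ω) =
        fun s ↦ 2 / Loewner.flowProc W' x s.toNNReal ω - ρ * J s.toNNReal ω := by
      funext s; rw [hreg]
    rw [hfun]
    have hii : IntervalIntegrable (fun s : ℝ ↦ 2 / Loewner.flowProc W' x s.toNNReal ω - ρ * J s.toNNReal ω)
        volume 0 t := (h2 t).sub ((hJ t).const_mul ρ)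
    exact Iff.mpr integrableOn_Icc_iff_integrableOn_Ioc
      ((intervalIntegrable_iff_integrableOn_Ioc_of_le t.coe_nonneg).1 hii)
  · filter_upwards [hgood] with ω ⟨hreg, _, _, heq⟩ t
    have hfun : (fun s : ℝ ↦ 2 / flowReg W' x s.toNNReal ω - ρ * J s.toNNReal ω) =
        fun s ↦ 2 / Loewner.flowProc W' x s.toNNReal ω - ρ * J s.toNNReal ω := by
      funext s; rw [hreg]
    rw [hfun, hreg t, hreg 0, heq t, heq 0]
    have hB0 : brownian 0 ω = 0 := by rw [brownian_zero]; rfl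
    simp only [intervalIntegral.integral_same, add_zero, NNReal.coe_zero, hB0, mul_zero, sub_zero]
    ring

/-- **`logCut δ (X_t) - ∫₀ᵗ logCutDrift κ ρ δ (X_s) (J_s) ds` is a martingale** for the clamped
progressive flow `X` of a regular version from a point `x > 0` that is a.s. never swallowed, for
every level `δ > 0`: Itô's formula in the form `martingale_apply_sub_timeIntegral_of_deriv_bounded`
for the `C²` function `logCut δ` (derivative bounded by `2/δ` on `[0, ∞) ∋ X`) along the Itô process
`dX = (2/X - ρ J) dt - √κ dB`. For `δ ≤ X` the martingale is Rohde–Schramm's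
`log X_t - ∫₀ᵗ (2 - κ/2) X_s⁻² ds` corrected by the SLE(κ, ρ) drift `ρ ∫₀ᵗ J_s/X_s ds`.
[cite: RohdeSchramm2005, proof of Lemma 7.2 (p. 909)] -/
theorem martingale_logCut_flowReg (h : RegularPair κ ρ W W' J) (hx : 0 < x) {δ : ℝ} (hδ : 0 < δ)
    (hT : ∀ᵐ ω ∂preWienerMeasure, Loewner.swallowingTime (fun s ↦ W s ω) x = ⊤) :
    Martingale (fun t ω ↦ logCut δ (flowReg W' x t ω) -
        timeIntegral (fun s ω ↦ logCutDrift κ ρ δ (flowReg W' x s ω) (J s ω)) t ω)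
      brownianFiltration preWienerMeasure := by
  have hM := martingale_apply_sub_timeIntegral_of_deriv_bounded (contDiff_logCut hδ)
    (h.stronglyAdapted_flowReg hx) (h.isStronglyProgressive_flowReg hx) (h.isStronglyProgressive_drift hx)
    (isStronglyProgressive_const _ _) (h.isItoProcess_flowReg hx hT) (h.flowReg_zero hx)
    (C₁ := 2 / δ) (Cσ := Real.sqrt κ)
    (fun t ω ↦ by rw [deriv_logCut hδ]; exact abs_logCutD_le hδ (flowReg_nonneg W' x t ω))
    (fun _ _ ↦ by rw [abs_neg, abs_of_nonneg (Real.sqrt_nonneg _)])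
  have hfun : (fun s ω ↦ (2 / flowReg W' x s ω - ρ * J s ω) * deriv (logCut δ) (flowReg W' x s ω) +
      2⁻¹ * (-Real.sqrt κ) ^ 2 * iteratedDeriv 2 (logCut δ) (flowReg W' x s ω)) =
      fun s ω ↦ logCutDrift κ ρ δ (flowReg W' x s ω) (J s ω) := by
    funext s ω
    exact itoDrift_logCut_eq κ ρ hδ _ _
  rw [hfun] at hM
  exact hM

/-- The martingale of `martingale_logCut_flowReg` starts at `logCut δ x` (every sample). [folklore] -/
theorem logCut_flowReg_zero (h : RegularPair κ ρ W W' J) (hx : 0 < x) (δ : ℝ) (ω : ℝ≥0 → ℝ) :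
    logCut δ (flowReg W' x 0 ω) -
      timeIntegral (fun s ω ↦ logCutDrift κ ρ δ (flowReg W' x s ω) (J s ω)) 0 ω = logCut δ x := by
  rw [h.flowReg_zero hx, timeIntegral_apply_zero, sub_zero]

end RegularPair

end SLEKappaRho

end Literature.Probability.RandomPlanarGeometry

end
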